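import Mathlib
import HarnessLib
import Summits.Ventures.LatticeQCDFlow.Scoring.MartingaleArrayCLT
import Literature.NumberTheory.Sieve.BombieriAsymptoticSieveMertens

/-!
# LatticeQCDFlow / Scaling — THE CENTRAL LIMIT THEOREM FOR MARTINGALE (LIKELIHOOD-RATIO)
# LOG-WEIGHTS: increments that are small with quadratic variation `→ s` give `L ⇒ N(−s/2, s)` and
# `E e^{L} = 1` — autoregressive (site-by-site) flows included

HONEST FRAMING: exact (Metropolis-corrected) sampling algorithms for lattice gauge theory;
figures of merit are autocorrelation/cost numbers at stated couplings and volumes; no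
continuum-physics claim.

Venture `LatticeQCDFlow` (cell pub-lqcd), topic `Scaling`; FANOUT row 3 (`s0-u1-a`, S0-B
implementation A, GEN-19).  NEW WORK of the cell, assembled on row 4's McLeish martingale array CLT
(`Scoring/MartingaleArrayCLT.tendstoInDistribution_rowSum_of_orthogonal`) and Mathlib's Slutsky
lemma; NO definition is introduced; nothing is cited (McLeish 1974 NAMED ONLY, through row 4's
file).  The acceptance consequence (`→ erfc(√s/2)`, through row 3's bridge
`Scaling/LogNormalLimitBridge`) is `Scaling/MartingaleLogNormalUniversality`.

## The statement

Every flow density on a product of `k` sites factorises autoregressively, so its log-weight against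
the target is a sum `L = Σ_{t<k} ℓ_t` of per-site conditional log-likelihood ratios, and under the
proposal the factors `e^{ℓ_t}` have conditional mean one: `E[F(ℓ_0,…,ℓ_{t−1})·(e^{ℓ_t} − 1)] = 0`
for every bounded measurable `F` (the LIKELIHOOD-RATIO MARTINGALE property; for a factorised flow it
is independence + normalisation).  For an array `ℓ_{n,t}` (`t < k_n`) of such increments on one
probability space with `|ℓ_{n,t}| ≤ c_n → 0` and quadratic variation `Σ_t ℓ_{n,t}² → s` IN PROBABILITY:

* **`martingale_rowSum_tendstoInDistribution`** — `Σ_t ℓ_{n,t} ⇒ N(−s/2, s)`: the martingale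
  differences `η = e^{ℓ} − 1` obey McLeish's theorem (`Σ η ⇒ N(0, s)`), and
  `ℓ = log(1 + η) = η − η²/2 + O(η³)` turns the quadratic variation into the drift `−s/2` (Slutsky);
* `martingale_integral_exp_rowSum_eq_one` — `E e^{L_n} = 1` exactly (induction on the sites).

## Content (all `[ours]`)

§1 real estimates (`|log(1+η) − η + η²/2| ≤ 2|η|³`, `|η² − x²| ≤ 3|x|³`; `|e^x − 1| ≤ |x|e^{|x|}` is REUSED
from `Literature/NumberTheory/Sieve/BombieriAsymptoticSieveMertens` — found by the gate's statement index);
§2 `tendstoInMeasure_of_abs_sub_affine_le` (a comparison lemma for convergence in probability);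
§3 the two theorems above.

NOT CLAIMED: the verification of the martingale property for a concrete flow architecture (it is the
chain rule for conditional densities; the kernel-level statement is not typed here); unbounded
increments (Lindeberg); rates; any value at the cell's `(β, L)`; nothing re-scored.
-/

noncomputable section

namespace Summit.Ventures.LatticeQCDFlow.Theory2

open MeasureTheory ProbabilityTheory Filter Finset Real Set
open scoped Topology NNReal

/-! ## §1 Real estimates -/

section RealEstimates

/-- `|log(1 + η) − η + η²/2| ≤ 2|η|³` for `|η| ≤ 1/2` (Mathlib's `Real.abs_log_sub_add_sum_range_le`
at order two, `x = −η`). [folklore] -/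
theorem abs_log_one_add_taylor_two_le {η : ℝ} (hη : |η| ≤ 1 / 2) :
    |Real.log (1 + η) - η + η ^ 2 / 2| ≤ 2 * |η| ^ 3 := by
  have hx : |(-η)| < 1 := by rw [abs_neg]; linarith
  have h := Real.abs_log_sub_add_sum_range_le hx 2
  have e1 : (∑ i ∈ Finset.range 2, (-η) ^ (i + 1) / ((i : ℝ) + 1)) = -η + η ^ 2 / 2 := by
    norm_num [Finset.sum_range_succ]
  rw [e1, sub_neg_eq_add, abs_neg, show (2 : ℕ) + 1 = 3 from rfl] at h
  have e2 : -η + η ^ 2 / 2 + Real.log (1 + η) = Real.log (1 + η) - η + η ^ 2 / 2 := by ring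
  rw [e2] at h
  refine h.trans ?_
  have h12 : 1 / 2 ≤ 1 - |η| := by linarith
  rw [div_le_iff₀ (by linarith)]
  have h3 : 0 ≤ |η| ^ 3 := pow_nonneg (abs_nonneg η) 3
  have := mul_le_mul_of_nonneg_left (show (1 : ℝ) ≤ 2 * (1 - |η|) by linarith) h3
  linarith

/-- For `η = e^x − 1` with `|x| ≤ 1`: `|η² − x²| ≤ 3|x|³`. [folklore] -/
theorem abs_expm1_sq_sub_sq_le {x : ℝ} (hx : |x| ≤ 1) :
    |(Real.exp x - 1) ^ 2 - x ^ 2| ≤ 3 * |x| ^ 3 := by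
  have h1 : |Real.exp x - 1 - x| ≤ x ^ 2 := Real.abs_exp_sub_one_sub_id_le hx
  have h2 : |Real.exp x - 1| ≤ 2 * |x| := Real.abs_exp_sub_one_le hx
  have e : (Real.exp x - 1) ^ 2 - x ^ 2 = (Real.exp x - 1 - x) * ((Real.exp x - 1) + x) := by ring
  rw [e, abs_mul]
  calc |Real.exp x - 1 - x| * |Real.exp x - 1 + x| ≤ x ^ 2 * (2 * |x| + |x|) := by
        refine mul_le_mul h1 ((abs_add_le _ _).trans (add_le_add h2 le_rfl)) (abs_nonneg _)
          (sq_nonneg _)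
    _ = 3 * |x| ^ 3 := by rw [← sq_abs]; ring

end RealEstimates

/-! ## §2 A comparison lemma for convergence in probability -/

section InMeasure

variable {Ω : Type*} [MeasurableSpace Ω] {P : Measure Ω}

/-- **Comparison for convergence in probability**: if `Xₙ → s` in measure and eventually
`|Yₙ − (αXₙ + β)| ≤ aₙ|Xₙ|` pointwise with `aₙ → 0`, then `Yₙ → αs + β` in measure. [ours] -/
theorem tendstoInMeasure_of_abs_sub_affine_le {X Y : ℕ → Ω → ℝ} {s α β : ℝ} {a : ℕ → ℝ}
    (hX : TendstoInMeasure P X atTop (fun _ => s)) (ha : Tendsto a atTop (𝓝 0))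
    (hYX : ∀ᶠ n in atTop, ∀ ω, |Y n ω - (α * X n ω + β)| ≤ a n * |X n ω|) :
    TendstoInMeasure P Y atTop (fun _ => α * s + β) := by
  rw [tendstoInMeasure_iff_dist] at hX ⊢
  intro ε hε
  -- choose `δ ≤ 1` with `(|α| + 1)δ ≤ ε/2`, then `n` large with `aₙ ≤ 1`, `aₙ(|s| + 1) ≤ ε/2`
  set δ : ℝ := min 1 (ε / (2 * (|α| + 1))) with hδ
  have hδpos : 0 < δ := lt_min one_pos (by positivity)
  have hδ1 : δ ≤ 1 := min_le_left _ _
  have hδ2 : (|α| + 1) * δ ≤ ε / 2 := by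
    have : δ ≤ ε / (2 * (|α| + 1)) := min_le_right _ _
    rw [le_div_iff₀ (by positivity)] at this
    linarith
  have ha1 : ∀ᶠ n in atTop, |a n| ≤ 1 := by
    have := (Metric.tendsto_nhds.1 ha) 1 one_pos
    filter_upwards [this] with n hn
    simpa [Real.dist_eq] using hn.le
  have ha2 : ∀ᶠ n in atTop, |a n| * (|s| + 1) ≤ ε / 2 := by
    have hpos : 0 < ε / 2 / (|s| + 1) := by positivity
    have := (Metric.tendsto_nhds.1 ha) _ hpos
    filter_upwards [this] with n hn
    have hn' : |a n| < ε / 2 / (|s| + 1) := by simpa [Real.dist_eq] using hn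
    rw [lt_div_iff₀ (by positivity)] at hn'
    exact hn'.le
  -- on `{dist (X n ω) s < δ}` we get `dist (Y n ω) (αs+β) < ε`
  have hsub : ∀ᶠ n in atTop, {ω | ε ≤ dist (Y n ω) (α * s + β)} ⊆ {ω | δ ≤ dist (X n ω) s} := by
    filter_upwards [hYX, ha1, ha2] with n hn h1 h2 ω hω
    simp only [Set.mem_setOf_eq, Real.dist_eq] at hω ⊢
    by_contra hlt
    push Not at hlt
    have hb := hn ω
    have hXb : |X n ω| ≤ |s| + 1 := by
      have := abs_sub_abs_le_abs_sub (X n ω) s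
      linarith
    have : |Y n ω - (α * s + β)| < ε := by
      calc |Y n ω - (α * s + β)|
          = |(Y n ω - (α * X n ω + β)) + α * (X n ω - s)| := by ring_nf
        _ ≤ |Y n ω - (α * X n ω + β)| + |α * (X n ω - s)| := abs_add_le _ _
        _ ≤ a n * |X n ω| + |α| * |X n ω - s| := by rw [abs_mul]; exact add_le_add hb le_rfl
        _ ≤ |a n| * (|s| + 1) + |α| * δ := by
            refine add_le_add ?_ (mul_le_mul_of_nonneg_left hlt.le (abs_nonneg α))
            exact (mul_le_mul_of_nonneg_right (le_abs_self _) (abs_nonneg _)).trans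
              (mul_le_mul_of_nonneg_left hXb (abs_nonneg _))
        _ < ε := by nlinarith [abs_nonneg α]
    linarith
  refine tendsto_of_tendsto_of_tendsto_of_le_of_le' tendsto_const_nhds (hX δ hδpos)
    (Filter.Eventually.of_forall fun _ => bot_le) ?_
  filter_upwards [hsub] with n hn using measure_mono hn

end InMeasure

/-! ## §3 Martingale log-weights -/

section Martingale

variable {Ω : Type*} [MeasurableSpace Ω] {P : Measure Ω} [IsProbabilityMeasure P]
  {ℓ : ℕ → ℕ → Ω → ℝ} {k : ℕ → ℕ}
variable {Ω' : Type*} [MeasurableSpace Ω'] {P' : Measure Ω'} [IsProbabilityMeasure P']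

/-- **`E e^{L} = 1`**: under the likelihood-ratio martingale property the mean weight of every
initial segment is one. [ours] -/
theorem martingale_integral_exp_rowSum_eq_one (hℓm : ∀ n t, Measurable (ℓ n t)) {c : ℕ → ℝ}
    (hc : ∀ n t ω, |ℓ n t ω| ≤ c n)
    (horth : ∀ (n t : ℕ) (F : (Fin t → ℝ) → ℝ) (K' : ℝ), Measurable F → (∀ w, |F w| ≤ K') →
      ∫ ω, F (fun i => ℓ n i ω) * (Real.exp (ℓ n t ω) - 1) ∂P = 0)
    (n m : ℕ) : ∫ ω, Real.exp (∑ t ∈ Finset.range m, ℓ n t ω) ∂P = 1 := by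
  induction m with
  | zero => simp
  | succ m ih =>
    -- `e^{Σ_{t<m+1}} = e^{Σ_{t<m}} + F(ℓ_{<m})·(e^{ℓ_m} − 1)` with `F` the clamped exponential of the sum
    set F : (Fin m → ℝ) → ℝ := fun w => Real.exp (∑ i, max (-(c n)) (min (c n) (w i))) with hF
    have hFm : Measurable F := by
      refine Real.measurable_exp.comp (Finset.measurable_sum _ fun i _ => ?_)
      exact (measurable_const.max (measurable_const.min (measurable_pi_apply i)))
    have hFb : ∀ w, |F w| ≤ Real.exp (m * c n) := fun w => by
      rw [abs_of_pos (Real.exp_pos _), Real.exp_le_exp]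
      calc ∑ i, max (-(c n)) (min (c n) (w i)) ≤ ∑ _i : Fin m, c n :=
            Finset.sum_le_sum fun i _ => max_le (by linarith [(abs_nonneg _).trans (hc n 0 (Classical.choice (by
              by_contra hne; rw [not_nonempty_iff] at hne
              exact absurd (IsProbabilityMeasure.measure_univ (μ := P)) (by simp [Set.univ_eq_empty_iff.2 hne]))))])
              (min_le_left _ _)
        _ = m * c n := by simp
    have hFeq : ∀ ω, F (fun i => ℓ n i ω) = Real.exp (∑ t ∈ Finset.range m, ℓ n t ω) := fun ω => by
      simp only [hF]
      congr 1
      rw [Finset.sum_range]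
      refine Finset.sum_congr rfl fun i _ => ?_
      have h1 := hc n i ω
      rw [abs_le] at h1
      rw [min_eq_right h1.2, max_eq_right h1.1]
    have hstep : ∀ ω, Real.exp (∑ t ∈ Finset.range (m + 1), ℓ n t ω)
        = Real.exp (∑ t ∈ Finset.range m, ℓ n t ω) + F (fun i => ℓ n i ω) * (Real.exp (ℓ n m ω) - 1) := by
      intro ω
      rw [Finset.sum_range_succ, Real.exp_add, hFeq]; ring
    simp_rw [hstep]
    have hi1 : Integrable (fun ω => Real.exp (∑ t ∈ Finset.range m, ℓ n t ω)) P := by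
      refine Integrable.of_mem_Icc 0 (Real.exp (m * c n)) (by fun_prop) (ae_of_all _ fun ω => ⟨(Real.exp_pos _).le, ?_⟩)
      rw [← hFeq]; exact (le_abs_self _).trans (hFb _)
    have hi2 : Integrable (fun ω => F (fun i => ℓ n i ω) * (Real.exp (ℓ n m ω) - 1)) P := by
      refine Integrable.of_mem_Icc (-(Real.exp (m * c n) * (Real.exp (c n) + 1)))
        (Real.exp (m * c n) * (Real.exp (c n) + 1)) ?_ (ae_of_all _ fun ω => ?_)
      · exact ((hFm.comp (measurable_pi_lambda _ fun i => hℓm n i)).mul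
          ((Real.measurable_exp.comp (hℓm n m)).sub measurable_const)).aemeasurable
      · have hb : |F (fun i => ℓ n i ω) * (Real.exp (ℓ n m ω) - 1)| ≤ Real.exp (m * c n) * (Real.exp (c n) + 1) := by
          rw [abs_mul]
          refine mul_le_mul (hFb _) ?_ (abs_nonneg _) (Real.exp_pos _).le
          calc |Real.exp (ℓ n m ω) - 1| ≤ |Real.exp (ℓ n m ω)| + |(1 : ℝ)| := abs_sub _ _
            _ ≤ Real.exp (c n) + 1 := by
                rw [abs_of_pos (Real.exp_pos _), abs_one]
                exact add_le_add (Real.exp_le_exp.2 ((le_abs_self _).trans (hc n m ω))) le_rfl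
        exact abs_le.1 hb
    rw [integral_add hi1 hi2, ih, horth n m F _ hFm hFb, add_zero]

/-- **THE LOG-WEIGHT OF A LIKELIHOOD-RATIO MARTINGALE ARRAY IS ASYMPTOTICALLY `N(−s/2, s)`.** [ours] -/
theorem martingale_rowSum_tendstoInDistribution (hℓm : ∀ n t, Measurable (ℓ n t)) {c : ℕ → ℝ}
    (hc : ∀ n t ω, |ℓ n t ω| ≤ c n) (hc0 : Tendsto c atTop (𝓝 0))
    (horth : ∀ (n t : ℕ) (F : (Fin t → ℝ) → ℝ) (K' : ℝ), Measurable F → (∀ w, |F w| ≤ K') →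
      ∫ ω, F (fun i => ℓ n i ω) * (Real.exp (ℓ n t ω) - 1) ∂P = 0)
    {s : ℝ} (hs : 0 ≤ s)
    (hQV : TendstoInMeasure P (fun n ω => ∑ t ∈ Finset.range (k n), ℓ n t ω ^ 2) atTop (fun _ => s))
    {Y : Ω' → ℝ} (hY : HasLaw Y (gaussianReal (-(s / 2)) s.toNNReal) P') :
    TendstoInDistribution (fun n ω => ∑ t ∈ Finset.range (k n), ℓ n t ω) atTop Y (fun _ => P) P' := by
  -- the martingale differences `η = e^ℓ − 1`
  set η : ℕ → ℕ → Ω → ℝ := fun n t ω => Real.exp (ℓ n t ω) - 1 with hη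
  have hηm : ∀ n t, Measurable (η n t) := fun n t => (Real.measurable_exp.comp (hℓm n t)).sub measurable_const
  -- their sure bound `c' = |c| e^{|c|} → 0`
  set c' : ℕ → ℝ := fun n => |c n| * Real.exp |c n| with hc'
  have hcc' : ∀ n t ω, |η n t ω| ≤ c' n := fun n t ω => by
    refine (Literature.NumberTheory.Sieve.BombieriSieve.abs_exp_sub_one_le _).trans ?_
    have h1 : |ℓ n t ω| ≤ |c n| := (hc n t ω).trans (le_abs_self _)
    exact mul_le_mul h1 (Real.exp_le_exp.2 h1) (Real.exp_pos _).le (abs_nonneg _)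
  have hc'0 : Tendsto c' atTop (𝓝 0) := by
    have h1 : Tendsto (fun n => |c n|) atTop (𝓝 0) := by simpa using hc0.abs
    have h2 : Tendsto (fun n => Real.exp |c n|) atTop (𝓝 (Real.exp 0)) :=
      (Real.continuous_exp.tendsto 0).comp h1
    simpa [hc'] using h1.mul h2
  -- orthogonality of `η` to bounded measurable functions of its own past
  have horth' : ∀ (n t : ℕ) (F : (Fin t → ℝ) → ℝ) (K' : ℝ), Measurable F → (∀ w, |F w| ≤ K') →
      ∫ ω, F (fun i => η n i ω) * η n t ω ∂P = 0 := by
    intro n t F K' hF hFb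
    have := horth n t (fun w => F (fun i => Real.exp (w i) - 1)) K'
      (hF.comp (measurable_pi_lambda _ fun i => (Real.measurable_exp.comp (measurable_pi_apply i)).sub
        measurable_const)) (fun w => hFb _)
    simpa [hη] using this
  -- quadratic variation of `η`: `Σ η² → s` in probability
  have hQV' : TendstoInMeasure P (fun n ω => ∑ t ∈ Finset.range (k n), η n t ω ^ 2) atTop (fun _ => s) := by
    have hev : ∀ᶠ n in atTop, c n ≤ 1 := hc0.eventually (ge_mem_nhds one_pos)
    have h := tendstoInMeasure_of_abs_sub_affine_le (α := 1) (β := 0) (a := fun n => 3 * c n)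
      (Y := fun n ω => ∑ t ∈ Finset.range (k n), η n t ω ^ 2) hQV (by simpa using hc0.const_mul 3) ?_
    · simpa using h
    filter_upwards [hev] with n hn ω
    rw [one_mul, add_zero, ← Finset.sum_sub_distrib]
    refine (Finset.abs_sum_le_sum_abs _ _).trans ?_
    rw [abs_of_nonneg (Finset.sum_nonneg fun t _ => sq_nonneg _), Finset.mul_sum]
    refine Finset.sum_le_sum fun t _ => ?_
    have h1 : |ℓ n t ω| ≤ 1 := (hc n t ω).trans hn
    calc |η n t ω ^ 2 - ℓ n t ω ^ 2| ≤ 3 * |ℓ n t ω| ^ 3 := abs_expm1_sq_sub_sq_le h1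
      _ = 3 * |ℓ n t ω| * ℓ n t ω ^ 2 := by rw [← sq_abs (ℓ n t ω)]; ring
      _ ≤ 3 * c n * ℓ n t ω ^ 2 := by
          refine mul_le_mul_of_nonneg_right ?_ (sq_nonneg _)
          exact mul_le_mul_of_nonneg_left (hc n t ω) (by norm_num)
  -- McLeish: `Σ η ⇒ N(0, s)`; the Gaussian `Y₀ = Y + s/2 ∼ N(0, s)`
  have hY0 : HasLaw (fun ω' => Y ω' + s / 2) (gaussianReal 0 s.toNNReal) P' := by
    have hadd : HasLaw (fun x : ℝ => x + s / 2) (gaussianReal 0 s.toNNReal)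
        (gaussianReal (-(s / 2)) s.toNNReal) := by
      refine ⟨(measurable_add_const _).aemeasurable, ?_⟩
      rw [gaussianReal_map_add_const]; congr 1; ring
    exact hadd.comp hY
  have hM := Summit.Ventures.LatticeQCDFlow.Scoring.tendstoInDistribution_rowSum_of_orthogonal
    (k := k) hηm hcc' hc'0 horth' hs hQV' hY0
  -- the drift: `L = Σ η − ½ Σ η² + R`, `|R| ≤ 2 c' Σ η²`
  have hev' : ∀ᶠ n in atTop, c' n ≤ 1 / 2 := hc'0.eventually (ge_mem_nhds (by norm_num))
  have hD : TendstoInMeasure P (fun n ω => ∑ t ∈ Finset.range (k n), ℓ n t ω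
      - ∑ t ∈ Finset.range (k n), η n t ω) atTop (fun _ => (-(1 / 2)) * s + 0) := by
    refine tendstoInMeasure_of_abs_sub_affine_le (a := fun n => 2 * c' n) hQV'
      (by simpa using hc'0.const_mul 2) ?_
    filter_upwards [hev'] with n hn ω
    rw [add_zero, ← Finset.sum_sub_distrib,
      show (-(1 / 2)) * ∑ t ∈ Finset.range (k n), η n t ω ^ 2 = ∑ t ∈ Finset.range (k n), (-(η n t ω ^ 2 / 2)) by
        rw [Finset.mul_sum]; exact Finset.sum_congr rfl fun t _ => by ring,
      ← Finset.sum_sub_distrib, abs_of_nonneg (Finset.sum_nonneg fun t _ => sq_nonneg (η n t ω)),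
      Finset.mul_sum]
    refine (Finset.abs_sum_le_sum_abs _ _).trans (Finset.sum_le_sum fun t _ => ?_)
    have hηt : |η n t ω| ≤ 1 / 2 := (hcc' n t ω).trans hn
    have hlog : ℓ n t ω = Real.log (1 + η n t ω) := by
      simp only [hη, add_sub_cancel, Real.log_exp]
    calc |ℓ n t ω - η n t ω - -(η n t ω ^ 2 / 2)| = |Real.log (1 + η n t ω) - η n t ω + η n t ω ^ 2 / 2| := by
          rw [hlog]; ring_nf
      _ ≤ 2 * |η n t ω| ^ 3 := abs_log_one_add_taylor_two_le hηt
      _ = 2 * |η n t ω| * η n t ω ^ 2 := by rw [← sq_abs (η n t ω)]; ring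
      _ ≤ 2 * c' n * η n t ω ^ 2 := by
          refine mul_le_mul_of_nonneg_right ?_ (sq_nonneg _)
          exact mul_le_mul_of_nonneg_left (hcc' n t ω) (by norm_num)
  -- Slutsky
  have hDm : ∀ n, AEMeasurable (fun ω => ∑ t ∈ Finset.range (k n), ℓ n t ω
      - ∑ t ∈ Finset.range (k n), η n t ω) P := fun n =>
    ((Finset.measurable_sum _ fun t _ => hℓm n t).sub
      (Finset.measurable_sum _ fun t _ => hηm n t)).aemeasurable
  have key := hM.add_of_tendstoInMeasure_const hD hDm
  have e1 : ∀ n, (fun ω => ∑ t ∈ Finset.range (k n), η n t ω)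
      + (fun ω => ∑ t ∈ Finset.range (k n), ℓ n t ω - ∑ t ∈ Finset.range (k n), η n t ω)
      = fun ω => ∑ t ∈ Finset.range (k n), ℓ n t ω := fun n => by
    funext ω; simp
  have e2 : (fun ω' => Y ω' + s / 2 + (-(1 / 2) * s + 0)) = Y := by
    funext ω'; ring
  rw [e2] at key
  simp_rw [e1] at key
  exact key

end Martingale

end Summit.Ventures.LatticeQCDFlow.Theory2

end
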